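import Mathlib
import HarnessLib

/-!
# The angle cube is a fundamental domain of the coordinate lattice: Lebesgue pieces of lattice-invariant sets may be measured in ANY fundamental domain

HONEST FRAMING: exact (Metropolis-corrected) sampling algorithms for lattice gauge theory;
figures of merit are autocorrelation/cost numbers at stated couplings and volumes; no
continuum-physics claim.

Venture `LatticeQCDFlow` (cell pub-lqcd), topic `Exactness`; FANOUT row 10 (`eng-equiv`, engine
`latflow.equiv` `spectral.py`: `unitary_eig` returns eigen-phases in `(−π, π]`; Algorithm 1 then
moves them by multiples of `2π` into the cell).  NEW WORK of the cell over Mathlib's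
`MeasureTheory.IsAddFundamentalDomain` (`mk'`, `measure_set_eq`), `existsUnique_add_zsmul_mem_Ioc`,
`AddSubgroup.pi` / `AddSubgroup.zmultiples`.  Nothing is cited as a fact; no number; no definition
(the lattice is Mathlib's `AddSubgroup.pi univ (fun _ => zmultiples T)` acting by translation).
Generic in the finite index type `κ`, the period `T > 0` and the window `(t, t + T]`; used with
`κ = Fin 2`, `T = 2π`, `t = −π` in `SU3AlcoveFundamentalDomain.lean` (step 2b of the `N = 3`
alcove programme, LEANMAP-eng-equiv-gen8 §C′).

## What is typed (`L = (Tℤ)^κ ≤ ℝ^κ`, `Q = (t, t + T]^κ`)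

* `countable_latticePi`, `mem_latticePi_iff`, `mem_latticePi_iff_exists` — the lattice is
  countable and its elements are the vectors `(m_k T)_k`, `m ∈ ℤ^κ`;
* **`isAddFundamentalDomain_cube`** — `Q` is a fundamental domain for the translation action of
  `L` on `ℝ^κ` with respect to Lebesgue measure (every point has exactly one lattice translate in
  `Q`, coordinate by coordinate);
* **`volume_inter_cube_eq_of_isAddFundamentalDomain`** — for ANY other fundamental domain `D`
  of `L` and any measurable `L`-invariant set `S`: `Leb(S ∩ Q) = Leb(S ∩ D)` (Mathlib's
  `IsAddFundamentalDomain.measure_set_eq` with the instances assembled).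

NOT here: the six Weyl chambers of the `SU(3)` alcove as the other fundamental domain
(`SU3AlcoveFundamentalDomain.lean`); any number.
-/

noncomputable section

namespace Summit.Ventures.LatticeQCDFlow.Exactness

open MeasureTheory Set

/-! ## The coordinate lattice `(Tℤ)^κ` -/

/-- **The coordinate lattice is countable.** -/
theorem countable_latticePi (κ : Type*) [Finite κ] (T : ℝ) :
    Countable (AddSubgroup.pi Set.univ fun _ : κ => AddSubgroup.zmultiples T) := by
  have h : ((AddSubgroup.pi Set.univ fun _ : κ => AddSubgroup.zmultiples T : AddSubgroup (κ → ℝ)) :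
      Set (κ → ℝ)).Countable := by
    rw [AddSubgroup.coe_pi]
    refine Set.countable_univ_pi fun _ => ?_
    rw [AddSubgroup.coe_zmultiples]
    exact Set.countable_range _
  exact h.to_subtype

variable {κ : Type*}

/-- **Lattice vectors, coordinatewise**: `v ∈ (Tℤ)^κ ↔ ∀ k, ∃ m_k ∈ ℤ, v_k = m_k T`. -/
theorem mem_latticePi_iff {T : ℝ} (v : κ → ℝ) :
    v ∈ AddSubgroup.pi Set.univ (fun _ : κ => AddSubgroup.zmultiples T) ↔ ∀ k, ∃ m : ℤ, v k = m * T := by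
  rw [AddSubgroup.mem_pi]
  refine forall_congr' fun k => ?_
  simp only [Set.mem_univ, true_implies, AddSubgroup.mem_zmultiples_iff, zsmul_eq_mul]
  exact ⟨fun ⟨m, hm⟩ => ⟨m, hm.symm⟩, fun ⟨m, hm⟩ => ⟨m, hm.symm⟩⟩

/-- **Lattice vectors are the integer vectors times `T`**: `v ∈ (Tℤ)^κ ↔ ∃ m ∈ ℤ^κ, v = (m_k T)_k`. -/
theorem mem_latticePi_iff_exists {T : ℝ} (v : κ → ℝ) :
    v ∈ AddSubgroup.pi Set.univ (fun _ : κ => AddSubgroup.zmultiples T) ↔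
      ∃ m : κ → ℤ, v = fun k => (m k : ℝ) * T := by
  rw [mem_latticePi_iff]
  constructor
  · intro h
    choose m hm using h
    exact ⟨m, funext hm⟩
  · rintro ⟨m, rfl⟩ k
    exact ⟨m k, rfl⟩

/-- The integer vector `m` times `T` is a lattice vector. -/
theorem intMul_mem_latticePi (T : ℝ) (m : κ → ℤ) :
    (fun k => (m k : ℝ) * T) ∈ AddSubgroup.pi Set.univ (fun _ : κ => AddSubgroup.zmultiples T) :=
  (mem_latticePi_iff_exists _).mpr ⟨m, rfl⟩

/-- The translation action of a lattice element is addition of its vector. -/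
theorem latticePi_vadd_eq {T : ℝ} (g : AddSubgroup.pi Set.univ (fun _ : κ => AddSubgroup.zmultiples T))
    (x : κ → ℝ) : g +ᵥ x = (g : κ → ℝ) + x := rfl

/-! ## The cube is a fundamental domain -/

variable [Fintype κ]

/-- **The cube `(t, t + T]^κ` is a fundamental domain of the coordinate lattice `(Tℤ)^κ` acting on
`ℝ^κ` by translation** (Lebesgue measure): every point has exactly one lattice translate in the
cube, one coordinate at a time (`existsUnique_add_zsmul_mem_Ioc`). -/
theorem isAddFundamentalDomain_cube {T : ℝ} (hT : 0 < T) (t : ℝ) :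
    IsAddFundamentalDomain (AddSubgroup.pi Set.univ fun _ : κ => AddSubgroup.zmultiples T)
      (Set.pi Set.univ fun _ : κ => Ioc t (t + T)) (volume : Measure (κ → ℝ)) := by
  refine IsAddFundamentalDomain.mk' ?_ fun x => ?_
  · exact (MeasurableSet.univ_pi fun _ => measurableSet_Ioc).nullMeasurableSet
  · have hk : ∀ k, ∃! m : ℤ, x k + m • T ∈ Ioc t (t + T) :=
      fun k => existsUnique_add_zsmul_mem_Ioc hT (x k) t
    choose m hm using hk
    refine ⟨⟨fun k => (m k : ℝ) * T, intMul_mem_latticePi T m⟩, ?_, ?_⟩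
    · beta_reduce
      rw [latticePi_vadd_eq, Set.mem_univ_pi]
      intro k
      have h : x k + m k • T ∈ Ioc t (t + T) := (hm k).1
      rw [zsmul_eq_mul] at h
      simpa only [Pi.add_apply, add_comm (x k)] using h
    · rintro ⟨g, hg⟩ hgx
      rw [latticePi_vadd_eq, Set.mem_univ_pi] at hgx
      obtain ⟨m', hm'⟩ := (mem_latticePi_iff_exists g).mp hg
      subst hm'
      congr 1
      funext k
      have hk' : x k + m' k • T ∈ Ioc t (t + T) := by
        have h := hgx k
        rw [zsmul_eq_mul]
        simpa only [Pi.add_apply, add_comm (x k)] using h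
      rw [(hm k).2 (m' k) hk']

/-- **Lebesgue pieces of lattice-invariant sets may be measured in any fundamental domain.**  For
any fundamental domain `D` of the coordinate lattice `(Tℤ)^κ` (Lebesgue measure) and any measurable
set `S ⊆ ℝ^κ` invariant under the integer translations `θ ↦ (m_k T)_k + θ`:
`Leb(S ∩ (t, t + T]^κ) = Leb(S ∩ D)`. -/
theorem volume_inter_cube_eq_of_isAddFundamentalDomain {T : ℝ} (hT : 0 < T) (t : ℝ) {D : Set (κ → ℝ)}
    (hD : IsAddFundamentalDomain (AddSubgroup.pi Set.univ fun _ : κ => AddSubgroup.zmultiples T) D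
      (volume : Measure (κ → ℝ)))
    {S : Set (κ → ℝ)} (hS : MeasurableSet S)
    (hinv : ∀ m : κ → ℤ, (fun θ : κ → ℝ => (fun k => (m k : ℝ) * T) + θ) ⁻¹' S = S) :
    volume (S ∩ Set.pi Set.univ fun _ : κ => Ioc t (t + T)) = volume (S ∩ D) := by
  haveI := countable_latticePi κ T
  refine (isAddFundamentalDomain_cube hT t).measure_set_eq hD hS fun g => ?_
  obtain ⟨m, hm⟩ := (mem_latticePi_iff_exists (g : κ → ℝ)).mp g.2
  have h : (fun x : κ → ℝ => g +ᵥ x) = fun θ => (fun k => (m k : ℝ) * T) + θ := by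
    funext θ
    rw [latticePi_vadd_eq, hm]
  rw [h]
  exact hinv m

/-- **The same, for sums over finitely many disjoint measurable pieces of the other domain**: if
`D = ⋃_σ C σ` (finite index type) with the `C σ` measurable and pairwise disjoint, then
`Leb(S ∩ (t, t + T]^κ) = Σ_σ Leb(S ∩ C σ)`. -/
theorem volume_inter_cube_eq_sum_of_isAddFundamentalDomain {T : ℝ} (hT : 0 < T) (t : ℝ)
    {G : Type*} [Fintype G] {C : G → Set (κ → ℝ)} (hC : ∀ σ, MeasurableSet (C σ))
    (hdisj : Pairwise fun σ σ' => Disjoint (C σ) (C σ'))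
    (hD : IsAddFundamentalDomain (AddSubgroup.pi Set.univ fun _ : κ => AddSubgroup.zmultiples T) (⋃ σ, C σ)
      (volume : Measure (κ → ℝ)))
    {S : Set (κ → ℝ)} (hS : MeasurableSet S)
    (hinv : ∀ m : κ → ℤ, (fun θ : κ → ℝ => (fun k => (m k : ℝ) * T) + θ) ⁻¹' S = S) :
    volume (S ∩ Set.pi Set.univ fun _ : κ => Ioc t (t + T)) = ∑ σ, volume (S ∩ C σ) := by
  rw [volume_inter_cube_eq_of_isAddFundamentalDomain hT t hD hS hinv, Set.inter_iUnion,
    measure_iUnion (fun σ σ' h => (hdisj h).mono Set.inter_subset_right Set.inter_subset_right)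
      (fun σ => hS.inter (hC σ)), tsum_fintype]

end Summit.Ventures.LatticeQCDFlow.Exactness
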